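import Mathlib
import Summits.QuantumFields.BalabanUV.Beta.CoarseCoerciveQuasiReconstruction

/-!
# [Balaban1984PropagatorsII] (2.72)–(2.78) p. 236 — THE BUMP CALCULUS FOR E-I3: the two inputs of
# `CoarseCoerciveQuasiReconstruction.sandwich_coercive_of_quasiReconstruction` (MASS coercivity `c`, ENERGY `E` of a
# quasi-reconstruction) reduced to FOUR COMBINATORIAL MAXIMA of the bump family — Schur's test in `ℓ²` for the
# superposition (`‖Σ_y B_y r_y‖² ≤ S₁S₂‖B‖²`) and for its bond differences under a Gram-dominated form
# `Re z*Az ≤ μ‖z‖² + ‖Dz‖²` (`‖D Σ_y B_y r_y‖² ≤ θ₁θ₂‖B‖²`), so `E = μS₁S₂ + θ₁θ₂` (cell topic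
# `Summits/QuantumFields/BalabanUV/Beta`; row-D4 interface item (I3), the counting engine under NOTE-I3's E-I3 at U = 1)

HONEST FRAMING (cell rule).  Discharging `BetaPertH` makes Bałaban's UV stability UNCONDITIONAL — a real constructive-QFT
result; NOT the continuum limit, NOT the Clay problem.  This module discharges NOTHING of `BetaPertH`.  [folklore] linear
algebra (Cauchy–Schwarz), kernel-checked.  WHY: NOTE-I3 (`HOME/b2b-balaban-beta-an4/g39/NOTE-I3-coarse-coercivity.md`)
isolates E-I3 — a bounded-energy quasi-reconstruction for Bałaban's averaging `Q̃` relative to the fine form `A = G₂⁻¹`,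
UNIFORM in the block size — as interface item (I3)'s one print-level estimate; `AnalyticWalkSum216RowConstrainedCoercive`
turns such a quasi-reconstruction into the co-owner's coercivity datum `hRe`.  This file makes «bounded energy» COUNTABLE:
for ANY fine form dominated by a Gram form `μ‖z‖² + ‖Dz‖²` (`D` = the bond-difference ∕ incidence matrix of a lattice
Laplacian, or any operator) and ANY bump family `r`, the energy constant is `E = μ·S₁·S₂ + θ₁·θ₂` with
`S₁ = max_x Σ_y |r_y(x)|` (overlap), `S₂ = max_y Σ_x |r_y(x)|` (mass of one bump), `θ₁ = max_b Σ_y |(Dr_y)_b|` (bumps varying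
on one bond × slope), `θ₂ = max_y Σ_b |(Dr_y)_b|` (total variation of one bump) — Schur's test twice.  THE U = 1 MODEL NODE
(offered, journal l.14232; NOT built here): on a box∕torus of ℤ^ν with blocks of side `n`, `A = (graph Laplacian) + μ`
(`μ ~ a∕n²`), product trapezoid bumps (≡ 1 on the block, linear ramps of width `w` into the neighbours, `2w ≤ n`):
`S₁ ≤ 2^ν`, `S₂ ≤ (n + 2w)^ν`, `θ₁ ≤ 2^ν∕w`, `θ₂ ≤ 2ν(n + 2w)^{ν−1}`, mass diagonal `1`, off-diagonal row sums
`≤ (1 + w∕n)^ν − 1` (so `w ≤ n∕(4ν)` gives `σ ≤ e^{1∕4} − 1 < ⅓`, `c ≥ ⅔`; NOT `w = n∕2` in `ν ≥ 2`) — with `w ∼ n∕(4ν)` the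
numbers `c` and `E·n^{2−ν}` are n-free: B6 (2.76)'s «γ₀ absolute» by counting, no Fourier analysis.  Nothing of
Bałaban's operators is instantiated; NO class change on any GAPS row (G-B9-15 decomposed, not closed); readiness width 0
unchanged; NOT summit progress.  Unit `b2b-balaban-beta-an4-g39` (owner lineage of `BINDER-OWNERS.md` row D4); `GAPS.md`
C-an4-106.

CITATION HEADER (lean-in-tree rule).  [B6] = T. Bałaban, *Propagators and renormalization transformations for lattice
gauge theories. II*, Commun. Math. Phys. **96**, 223–250 (1984) [Balaban1984PropagatorsII], (2.72)–(2.78) p. 236 (render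
read 2026-08-20; quoted in `CoarseCoerciveQuasiReconstruction`'s header).  LOCATOR only; nothing printed is asserted.

WHAT IS CERTIFIED HERE (kernel, sorry-free; [folklore]).
§1 `norm_sq_dot_le` (weighted Cauchy–Schwarz), **`nsq_mulVec_le_schur`** — Schur's test in `ℓ²`: absolute row sums
   `≤ R`, absolute column sums `≤ C` ⟹ `‖T B‖² ≤ R·C·‖B‖²`.
§2 `superpose_apply` (`(Σ_y B_y r_y)(x) = Σ_y r_y(x)B_y`), **`nsq_superpose_le`** (`≤ S₁S₂‖B‖²`), `bondPairing`
   (`(D·(Qm r)ᴴ) b y = Σ_x D b x·r_y(x)`), **`nsq_mulVec_superpose_le`** (`‖D(Σ B_y r_y)‖² ≤ θ₁θ₂‖B‖²`),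
   **`energy_superpose_le`** (Gram-dominated form ⟹ `E = μS₁S₂ + θ₁θ₂`).
§3 **`coarse_coercive_of_bumps`** — the assembly with `sandwich_coercive_of_quasiReconstruction` and
   `massCoercive_of_diagDominant`: `((δ − σ)²∕(μS₁S₂ + θ₁θ₂))·‖B‖² ≤ Re B*(Q A⁻¹ Q*)B`.
§4 Non-vacuity (one site, one block, no bonds).
NOT CLAIMED.  Any lattice instance (the trapezoid numbers above are the MODEL node's to certify); anything about
Bałaban's operators; k-uniformity.  NOT summit progress.
PRIOR ART IN THE TREE (searched 2026-08-20: `lean search 'schur|Schur|nsq_mulVec'`): `B5Prop11Lower.nsq_mulVec_le`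
(operator-norm version `‖XB‖² ≤ ‖X‖²‖B‖²` — not the row∕column-sum form); `Literature/Analysis/Matrix/GramRowSumBound`
(Schur row-sum bound for `‖TT*‖`); `Literature/Analysis/Hypoelliptic/WeightedL2`∕`Pairing` (`schur_test_conv`: Schur's
test for convolution kernels on weighted `L²` — continuum objects); d4-p3's `UnitLatticeProjectionWalk` (reconstruction
energies as HYPOTHESES `hen`).  No finite-index `ℓ²` Schur test with `nsq` in the tree.
-/

namespace Summit.QuantumFields.BalabanUV.Beta.CoarseCoerciveBumpCalculus

open scoped BigOperators Matrix ComplexConjugate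
open Finset Matrix
open Summit.QuantumFields.BalabanUV.Beta.AccretiveCombesThomasSandwich (sandwich)
open Summit.QuantumFields.BalabanUV.Beta.UnitLatticeResolventWalk (Qm superpose)
open Summit.QuantumFields.BalabanUV.Beta.CoarseCoerciveQuasiReconstruction (sandwich_coercive_of_quasiReconstruction
  massMatrix massCoercive_of_diagDominant)
open Literature.MathematicalPhysics.QuantumFieldTheory.Balaban1983to89.B5Prop11Lower (nsq nsq_nonneg
  star_dotProduct_self)

noncomputable section

variable {ι X Y : Type*} [Fintype ι] [Fintype X] [Fintype Y] [DecidableEq X] [DecidableEq Y]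

/-! ## §1 Schur's test in `ℓ²` -/

omit [Fintype ι] [Fintype X] [DecidableEq X] [DecidableEq Y] in
/-- Weighted Cauchy–Schwarz for one row: `‖Σ_y T_y B_y‖² ≤ (Σ_y ‖T_y‖)·(Σ_y ‖T_y‖‖B_y‖²)`. [folklore] -/
theorem norm_sq_dot_le (T B : Y → ℂ) : ‖∑ y, T y * B y‖ ^ 2 ≤ (∑ y, ‖T y‖) * ∑ y, ‖T y‖ * ‖B y‖ ^ 2 := by
  calc ‖∑ y, T y * B y‖ ^ 2 ≤ (∑ y, ‖T y‖ * ‖B y‖) ^ 2 := by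
        gcongr
        exact (norm_sum_le _ _).trans (le_of_eq (Finset.sum_congr rfl fun y _ => norm_mul _ _))
    _ ≤ (∑ y, ‖T y‖) * ∑ y, ‖T y‖ * ‖B y‖ ^ 2 :=
        Finset.sum_sq_le_sum_mul_sum_of_sq_le_mul _ (fun _ _ => norm_nonneg _) (fun _ _ => by positivity)
          (fun y _ => le_of_eq (by ring))

omit [Fintype X] [DecidableEq X] [DecidableEq Y] in
/-- **SCHUR'S TEST IN `ℓ²`**: absolute row sums of `T` `≤ R` (`R ≥ 0`) and absolute column sums `≤ C` ⟹
`‖T B‖² ≤ R·C·‖B‖²`. [folklore] -/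
theorem nsq_mulVec_le_schur (T : Matrix ι Y ℂ) {R C : ℝ} (hR0 : 0 ≤ R) (hR : ∀ i, ∑ y, ‖T i y‖ ≤ R)
    (hC : ∀ y, ∑ i, ‖T i y‖ ≤ C) (B : Y → ℂ) : nsq (T *ᵥ B) ≤ R * C * nsq B := by
  calc nsq (T *ᵥ B) = ∑ i, ‖∑ y, T i y * B y‖ ^ 2 := by simp [nsq, Matrix.mulVec, dotProduct]
    _ ≤ ∑ i, R * ∑ y, ‖T i y‖ * ‖B y‖ ^ 2 := Finset.sum_le_sum fun i _ =>
        (norm_sq_dot_le (T i) B).trans (mul_le_mul_of_nonneg_right (hR i) (Finset.sum_nonneg fun _ _ => by positivity))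
    _ = R * ∑ y, (∑ i, ‖T i y‖) * ‖B y‖ ^ 2 := by
        rw [← Finset.mul_sum, Finset.sum_comm]
        refine congrArg _ (Finset.sum_congr rfl fun y _ => by rw [Finset.sum_mul])
    _ ≤ R * ∑ y, C * ‖B y‖ ^ 2 := mul_le_mul_of_nonneg_left
        (Finset.sum_le_sum fun y _ => mul_le_mul_of_nonneg_right (hC y) (by positivity)) hR0
    _ = R * C * nsq B := by rw [← Finset.mul_sum, nsq, mul_assoc]

/-! ## §2 Superpositions of bumps: mass and energy by counting -/

omit [Fintype X] [DecidableEq X] [DecidableEq Y] in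
/-- `(Σ_y B_y r_y)(x) = Σ_y r_y(x)·B_y`. [folklore] -/
theorem superpose_apply (r : Y → X → ℂ) (B : Y → ℂ) (x : X) : superpose r B x = ∑ y, r y x * B y := by
  simp only [superpose, Matrix.mulVec, dotProduct, Matrix.conjTranspose_apply, Qm, Complex.star_def,
    Complex.conj_conj]

omit [Fintype X] [DecidableEq X] [DecidableEq Y] in
/-- The superposition IS a matrix–vector product with the (unconjugated) bump matrix `(x, y) ↦ r_y(x)`. [folklore] -/
theorem superpose_eq_mulVec (r : Y → X → ℂ) (B : Y → ℂ) : superpose r B = (Matrix.of fun x y => r y x) *ᵥ B := by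
  ext x
  rw [superpose_apply]
  rfl

omit [DecidableEq X] [DecidableEq Y] in
/-- **MASS OF A SUPERPOSITION**: overlap `S₁ = max_x Σ_y ‖r_y(x)‖` and bump mass `S₂ = max_y Σ_x ‖r_y(x)‖` give
`‖Σ_y B_y r_y‖² ≤ S₁S₂‖B‖²`. [folklore] -/
theorem nsq_superpose_le (r : Y → X → ℂ) {S₁ S₂ : ℝ} (hS0 : 0 ≤ S₁) (hS₁ : ∀ x, ∑ y, ‖r y x‖ ≤ S₁)
    (hS₂ : ∀ y, ∑ x, ‖r y x‖ ≤ S₂) (B : Y → ℂ) : nsq (superpose r B) ≤ S₁ * S₂ * nsq B := by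
  rw [superpose_eq_mulVec]
  exact nsq_mulVec_le_schur _ hS0 (fun x => by simpa using hS₁ x) (fun y => by simpa using hS₂ y) B

/-- THE BOND PAIRINGS of a bump family under an operator `D` (e.g. the bond differences): `t b y = Σ_x D b x · r_y(x)
= (D r_y)_b`. [folklore] -/
def bondPairing (D : Matrix ι X ℂ) (r : Y → X → ℂ) : Matrix ι Y ℂ := D * Matrix.of fun x y => r y x

omit [Fintype ι] [Fintype Y] [DecidableEq X] [DecidableEq Y] in
/-- Entries of the bond pairing. [folklore] -/
theorem bondPairing_apply (D : Matrix ι X ℂ) (r : Y → X → ℂ) (b : ι) (y : Y) :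
    bondPairing D r b y = ∑ x, D b x * r y x := rfl

omit [Fintype ι] [DecidableEq X] [DecidableEq Y] in
/-- `D(Σ_y B_y r_y) = (bondPairing D r)·B`. [folklore] -/
theorem mulVec_superpose (D : Matrix ι X ℂ) (r : Y → X → ℂ) (B : Y → ℂ) :
    D *ᵥ superpose r B = bondPairing D r *ᵥ B := by
  rw [superpose_eq_mulVec, Matrix.mulVec_mulVec, bondPairing]

omit [DecidableEq X] [DecidableEq Y] in
/-- **ENERGY OF A SUPERPOSITION, GRAM PART**: `θ₁ = max_b Σ_y ‖(Dr_y)_b‖` (bumps varying on one bond × slope) and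
`θ₂ = max_y Σ_b ‖(Dr_y)_b‖` (total variation of one bump) give `‖D(Σ_y B_y r_y)‖² ≤ θ₁θ₂‖B‖²`. [folklore] -/
theorem nsq_mulVec_superpose_le (D : Matrix ι X ℂ) (r : Y → X → ℂ) {θ₁ θ₂ : ℝ} (hθ0 : 0 ≤ θ₁)
    (hθ₁ : ∀ b, ∑ y, ‖bondPairing D r b y‖ ≤ θ₁) (hθ₂ : ∀ y, ∑ b, ‖bondPairing D r b y‖ ≤ θ₂) (B : Y → ℂ) :
    nsq (D *ᵥ superpose r B) ≤ θ₁ * θ₂ * nsq B := by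
  rw [mulVec_superpose]
  exact nsq_mulVec_le_schur _ hθ0 hθ₁ hθ₂ B

omit [DecidableEq X] [DecidableEq Y] in
/-- **ENERGY OF A SUPERPOSITION**: if the fine form is dominated by a Gram form, `Re z*Az ≤ μ‖z‖² + ‖Dz‖²` (`μ ≥ 0`),
then the bump data `(S₁, S₂, θ₁, θ₂)` give `Re (Σ B_yr_y)*A(Σ B_yr_y) ≤ (μS₁S₂ + θ₁θ₂)·‖B‖²`. [cite: Balaban1984PropagatorsII, (2.72)–(2.78) p.236] -/
theorem energy_superpose_le (A : Matrix X X ℂ) (D : Matrix ι X ℂ) {μ : ℝ} (hμ : 0 ≤ μ)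
    (hA : ∀ z : X → ℂ, (star z ⬝ᵥ (A *ᵥ z)).re ≤ μ * nsq z + nsq (D *ᵥ z)) (r : Y → X → ℂ) {S₁ S₂ θ₁ θ₂ : ℝ}
    (hS0 : 0 ≤ S₁) (hS₁ : ∀ x, ∑ y, ‖r y x‖ ≤ S₁) (hS₂ : ∀ y, ∑ x, ‖r y x‖ ≤ S₂) (hθ0 : 0 ≤ θ₁)
    (hθ₁ : ∀ b, ∑ y, ‖bondPairing D r b y‖ ≤ θ₁) (hθ₂ : ∀ y, ∑ b, ‖bondPairing D r b y‖ ≤ θ₂) (B : Y → ℂ) :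
    (star (superpose r B) ⬝ᵥ (A *ᵥ superpose r B)).re ≤ (μ * (S₁ * S₂) + θ₁ * θ₂) * nsq B := by
  have h1 := nsq_superpose_le r hS0 hS₁ hS₂ B
  have h2 := nsq_mulVec_superpose_le D r hθ0 hθ₁ hθ₂ B
  have h3 := hA (superpose r B)
  nlinarith

/-! ## §3 The assembly: coarse coercivity by counting -/

/-- **COARSE COERCIVITY BY COUNTING.**  `A` Hermitian, invertible, `Re`-psd and dominated by the Gram form
`μ‖z‖² + ‖Dz‖²`; block test vectors `q`; a bump family `r` with overlap `S₁`, mass `S₂`, bond data `θ₁`, `θ₂` and a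
Hermitian, diagonally dominant mass matrix (diagonal `≥ δ`, off-diagonal row sums `≤ σ < δ`).  Then
`((δ − σ)²∕(μS₁S₂ + θ₁θ₂))·‖B‖² ≤ Re B*(sandwich A q)B` — E-I3's two inputs supplied by four maxima and two mass numbers.
[cite: Balaban1984PropagatorsII, (2.72)–(2.78) p.236] -/
theorem coarse_coercive_of_bumps (A : Matrix X X ℂ) (hH : A.IsHermitian) (hU : IsUnit A)
    (hpsd : ∀ g : X → ℂ, 0 ≤ (star g ⬝ᵥ (A *ᵥ g)).re) (D : Matrix ι X ℂ) {μ : ℝ} (hμ : 0 ≤ μ)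
    (hA : ∀ z : X → ℂ, (star z ⬝ᵥ (A *ᵥ z)).re ≤ μ * nsq z + nsq (D *ᵥ z)) (q r : Y → X → ℂ) {S₁ S₂ θ₁ θ₂ δ σ : ℝ}
    (hS0 : 0 ≤ S₁) (hS₁ : ∀ x, ∑ y, ‖r y x‖ ≤ S₁) (hS₂ : ∀ y, ∑ x, ‖r y x‖ ≤ S₂) (hθ0 : 0 ≤ θ₁)
    (hθ₁ : ∀ b, ∑ y, ‖bondPairing D r b y‖ ≤ θ₁) (hθ₂ : ∀ y, ∑ b, ‖bondPairing D r b y‖ ≤ θ₂)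
    (hE : 0 < μ * (S₁ * S₂) + θ₁ * θ₂) (hMH : (massMatrix r q).IsHermitian) (hδ : ∀ y, δ ≤ (massMatrix r q y y).re)
    (hσ : ∀ y, ∑ y' ∈ univ.erase y, ‖massMatrix r q y y'‖ ≤ σ) (hδσ : σ < δ) (B : Y → ℂ) :
    (δ - σ) ^ 2 / (μ * (S₁ * S₂) + θ₁ * θ₂) * nsq B ≤ (star B ⬝ᵥ (sandwich A q *ᵥ B)).re :=
  sandwich_coercive_of_quasiReconstruction A hH hU hpsd q r (sub_pos.2 hδσ) hE
    (massCoercive_of_diagDominant r q hMH hδ hσ) (energy_superpose_le A D hμ hA r hS0 hS₁ hS₂ hθ0 hθ₁ hθ₂) B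

/-! ## §4 Non-vacuity: one site, one block, no bonds -/

/-- One fine site, one block, `A = 2`, no bonds (`ι` empty, `D` the empty matrix), Gram domination with `μ = 2`,
`q = r = 1`: `S₁ = S₂ = 1`, `θ₁ = θ₂ = 0`, mass matrix `(1)` so `δ = 1`, `σ = 0`; the theorem gives
`(1²∕2)‖B‖² ≤ Re B*(sandwich A q)B`. [folklore] -/
example (B : Unit → ℂ) :
    (1 - 0 : ℝ) ^ 2 / (2 * (1 * 1) + 0 * 0) * nsq B ≤
      (star B ⬝ᵥ (sandwich ((2 : ℂ) • (1 : Matrix Unit Unit ℂ)) (fun _ _ => (1 : ℂ)) *ᵥ B)).re := by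
  have hH : ((2 : ℂ) • (1 : Matrix Unit Unit ℂ)).IsHermitian := by
    rw [Matrix.IsHermitian, Matrix.conjTranspose_smul, Matrix.conjTranspose_one]
    norm_num
  have hU : IsUnit ((2 : ℂ) • (1 : Matrix Unit Unit ℂ)) := by
    rw [Matrix.isUnit_iff_isUnit_det, Matrix.det_smul, Matrix.det_one, mul_one, Fintype.card_unit, pow_one]
    exact isUnit_iff_ne_zero.2 two_ne_zero
  have hform : ∀ z : Unit → ℂ, (star z ⬝ᵥ (((2 : ℂ) • (1 : Matrix Unit Unit ℂ)) *ᵥ z)).re = 2 * nsq z := fun z => by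
    rw [Matrix.smul_mulVec, Matrix.one_mulVec, dotProduct_smul, smul_eq_mul, star_dotProduct_self,
      show (2 : ℂ) * ((nsq z : ℝ) : ℂ) = ((2 * nsq z : ℝ) : ℂ) by push_cast; ring, Complex.ofReal_re]
  have hM : massMatrix (fun (_ : Unit) (_ : Unit) => (1 : ℂ)) (fun _ _ => (1 : ℂ)) = 1 := by
    ext i j
    simp [massMatrix, Qm, Matrix.mul_apply, Matrix.conjTranspose_apply]
  refine coarse_coercive_of_bumps _ hH hU (fun g => by rw [hform]; exact mul_nonneg zero_le_two (nsq_nonneg g))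
    (Matrix.of fun (b : Empty) (_ : Unit) => (b.elim : ℂ)) zero_le_two (fun z => ?_) (fun _ _ => (1 : ℂ))
    (fun _ _ => (1 : ℂ)) zero_le_one
    (fun x => by simp) (fun y => by simp) le_rfl (fun b => b.elim) (fun y => by simp) (by norm_num) ?_ (fun y => ?_)
    (fun y => ?_) zero_lt_one B
  · rw [hform]
    linarith [nsq_nonneg (Matrix.of (fun (b : Empty) (_ : Unit) => (b.elim : ℂ)) *ᵥ z)]
  · rw [hM]; exact Matrix.isHermitian_one
  · rw [hM]; simp
  · rw [hM]
    simp

end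

end Summit.QuantumFields.BalabanUV.Beta.CoarseCoerciveBumpCalculus
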